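import Mathlib.Analysis.SpecialFunctions.Pow.Asymptotics
import HarnessLib

/-!
# `ConvergentOSClosure` (crux stmt-QuantumFields-11525), stub `stub_speciesCSClustering` (wave 2) —
# negative-side support: a FREE rate `∃ Δ' > 0` is not bought by uniform bounds + convergence

Mathlib-only witness for the wave-2 re-check of the reshaped stub
`… → sch.HasLatticeMassGap Δ → (convergence) → (P2: k-uniform E0′ bound) → ∃ Δ' > 0, sch.HasSpeciesCSClustering Δ'`.

DICTIONARY.  `F k t` stands for a smeared species truncated function of the step-`k` lattice at physical
time separation `t` (one entry of `ClustersCS 4 (qcdLatticeSchwinger sch) ·`), `L t` for its `k → ∞` limit.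
What the stub's hypotheses give such an `F`, at best, is:
(i)  at each FIXED `k` an exponential bound `F k t ≤ C_k e^{−t}` whose constant `C_k` is the largest per-pair
     constant of `HasLatticeMassGap` over the step-`k` family of translated / product insertion patterns —
     a `k`-DEPENDENT constant (the family grows like `a_k⁻⁴ · |supp|`);
(ii) a `k`-UNIFORM bound `F k t ≤ 1` (hypothesis P2, the E0′ bound of `qcdLatticeDist`, is uniform in `k`
     but carries no decay in `t`);
(iii) convergence `F k t → L t` (the convergence hypothesis; here even eventual equality).
The conclusion needs `∃ Δ' > 0, ∃ C, ∀ t ≥ 0, L t ≤ C e^{−Δ' t}` (up to the slack `ε`, removed by (iii)).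
`noRate_witness` exhibits `F k t = min (1/(1+t)) (e^{k−t})`, `L t = 1/(1+t)` with (i)–(iii) and NO rate:
the limit decays polynomially.  So the weakening "`Δ' free`" of wave 2 does not change the wave-1 verdict:
the tree's `LatticeGapOnTrajectory.Negative.perPair_clustering_does_not_transfer` (p114724) shows only that
the rate DROPS (its limit still clusters at rate `1/2`, which `∃ Δ'` would tolerate); this witness shows that
with `k`-dependent constants no rate at all survives, even under the uniform bound (ii).
`lean check`: see the analysis addendum.
-/

namespace Summit.QuantumFields.QCD.Theorems.ConvergentOSClosure.Negative

open Filter Topology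

/-- The witness family: `F k t = min (1/(1+t)) (e^{k−t})`. -/
noncomputable def noRateF (k : ℕ) (t : ℝ) : ℝ := min (1 / (1 + t)) (Real.exp (k - t))

/-- Its limit: `L t = 1/(1+t)`. -/
noncomputable def noRateL (t : ℝ) : ℝ := 1 / (1 + t)

theorem noRateF_nonneg (k : ℕ) {t : ℝ} (ht : 0 ≤ t) : 0 ≤ noRateF k t :=
  le_min (div_nonneg zero_le_one (by linarith)) (Real.exp_pos _).le

/-- (i) per-step exponential clustering at rate `1` with the step-dependent constant `e^k`. -/
theorem noRateF_le_exp (k : ℕ) (t : ℝ) : noRateF k t ≤ Real.exp k * Real.exp (-t) := by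
  calc noRateF k t ≤ Real.exp (k - t) := min_le_right _ _
    _ = Real.exp k * Real.exp (-t) := by rw [← Real.exp_add, sub_eq_add_neg]

/-- (ii) the `k`-uniform bound. -/
theorem noRateF_le_one (k : ℕ) {t : ℝ} (ht : 0 ≤ t) : noRateF k t ≤ 1 :=
  (min_le_left _ _).trans ((div_le_one (by linarith : (0 : ℝ) < 1 + t)).2 (by linarith))

/-- (iii) convergence, in the strong form of eventual equality. -/
theorem noRateF_eventually_eq {t : ℝ} (ht : 0 ≤ t) : ∀ᶠ k : ℕ in atTop, noRateF k t = noRateL t := by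
  obtain ⟨k₀, hk₀⟩ := exists_nat_ge t
  refine eventually_atTop.2 ⟨k₀, fun k hk => min_eq_left ?_⟩
  have h1 : 1 / (1 + t) ≤ 1 := (div_le_one (by linarith : (0 : ℝ) < 1 + t)).2 (by linarith)
  have hk' : (k₀ : ℝ) ≤ k := Nat.cast_le.2 hk
  have h2 : (1 : ℝ) ≤ Real.exp (k - t) := Real.one_le_exp (by linarith)
  exact h1.trans h2

theorem noRateF_tendsto {t : ℝ} (ht : 0 ≤ t) :
    Tendsto (fun k : ℕ => noRateF k t) atTop (𝓝 (noRateL t)) :=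
  tendsto_nhds_of_eventually_eq (noRateF_eventually_eq ht)

/-- (iv) the limit has NO exponential rate. -/
theorem noRateL_no_rate :
    ¬ ∃ Δ' > 0, ∃ C : ℝ, ∀ t : ℝ, 0 ≤ t → |noRateL t| ≤ C * Real.exp (-Δ' * t) := by
  rintro ⟨Δ, hΔ, C, hC⟩
  have hg : Tendsto (fun t : ℝ => C * ((1 + t) * Real.exp (-Δ * t))) atTop (𝓝 (C * 0)) := by
    refine Tendsto.const_mul C ?_
    have h := (tendsto_rpow_mul_exp_neg_mul_atTop_nhds_zero 0 Δ hΔ).add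
      (tendsto_rpow_mul_exp_neg_mul_atTop_nhds_zero 1 Δ hΔ)
    rw [add_zero] at h
    refine h.congr' ?_
    filter_upwards [eventually_ge_atTop (0 : ℝ)] with t ht
    rw [Real.rpow_zero, Real.rpow_one]
    ring
  rw [mul_zero] at hg
  obtain ⟨t, hlt, ht0⟩ := ((hg.eventually_lt_const zero_lt_one).and (eventually_ge_atTop 0)).exists
  have hpos : (0 : ℝ) < 1 + t := by linarith
  have hL := hC t ht0
  rw [noRateL, abs_of_pos (div_pos one_pos hpos), div_le_iff₀ hpos] at hL
  have : C * ((1 + t) * Real.exp (-Δ * t)) = C * Real.exp (-Δ * t) * (1 + t) := by ring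
  linarith

/-- **Uniform bounds + convergence + per-step clustering with step-dependent constants buy NO rate.**
One family `F : ℕ → ℝ → ℝ` with limit `L` has: non-negativity; at every step `k` exponential clustering at
rate `1` with SOME constant (`e^k`); the `k`-uniform bound `1`; eventual equality with (hence convergence to)
`L`; and yet `L` admits no bound `C e^{−Δ' t}` for ANY `Δ' > 0` — nor does `F` admit the slack form
`∃ Δ' > 0, ∃ C, ∀ t ≥ 0, ∀ ε > 0, ∀ᶠ k, F k t ≤ C e^{−Δ' t} + ε` of `ClustersCS`. [folklore] -/
theorem noRate_witness :
    ∃ (F : ℕ → ℝ → ℝ) (L : ℝ → ℝ),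
      (∀ k t, 0 ≤ t → 0 ≤ F k t) ∧
      (∀ k, ∃ C : ℝ, ∀ t, 0 ≤ t → F k t ≤ C * Real.exp (-t)) ∧
      (∀ k t, 0 ≤ t → F k t ≤ 1) ∧
      (∀ t, 0 ≤ t → ∀ᶠ k in atTop, F k t = L t) ∧
      (∀ t, 0 ≤ t → Tendsto (fun k => F k t) atTop (𝓝 (L t))) ∧
      (¬ ∃ Δ' > 0, ∃ C : ℝ, ∀ t : ℝ, 0 ≤ t → |L t| ≤ C * Real.exp (-Δ' * t)) ∧
      ¬ ∃ Δ' > 0, ∃ C : ℝ, ∀ t : ℝ, 0 ≤ t → ∀ ε : ℝ, 0 < ε →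
          ∀ᶠ k in atTop, F k t ≤ C * Real.exp (-Δ' * t) + ε := by
  refine ⟨noRateF, noRateL, fun k t ht => noRateF_nonneg k ht,
    fun k => ⟨Real.exp k, fun t _ => noRateF_le_exp k t⟩, fun k t ht => noRateF_le_one k ht,
    fun t ht => noRateF_eventually_eq ht, fun t ht => noRateF_tendsto ht, noRateL_no_rate, ?_⟩
  rintro ⟨Δ, hΔ, C, hC⟩
  refine noRateL_no_rate ⟨Δ, hΔ, C, fun t ht => ?_⟩
  have hpos : (0 : ℝ) < 1 + t := by linarith
  rw [abs_of_pos (show 0 < noRateL t from div_pos one_pos hpos)]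
  refine le_of_forall_pos_le_add fun ε hε => ?_
  obtain ⟨k, hk1, hk2⟩ := ((hC t ht ε hε).and (noRateF_eventually_eq ht)).exists
  rw [← hk2]
  exact hk1

end Summit.QuantumFields.QCD.Theorems.ConvergentOSClosure.Negative
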